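import Summits.CriticalPhenomena.Ising3D.ExclusionSentencesZetaValues

/-!
# Certified enclosure of Catalan's constant `G` (cell `pub-ising3x`, seat recog-1)

HONEST FRAMING: lottery ticket; floor = tightest certified 3D Ising CFT bounds; no exact-solution
claim without a proof.

`G = Σ_{n≥0} (−1)ⁿ/(2n+1)² = β(2) = 0.9159655941772190…` is the last `LIN`/`TRG` constant of FAMILIES-v1
(`HOME/frozen/FAMILIES-v1.json`, SCOPE.md §3.1) without Mathlib digits (`π`, `log 2`, `e`:
`ExclusionSentencesPiForms.lean`; `ζ(3)`, `ζ(5)`: `ExclusionSentencesZetaValues.lean`).  Here: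
* `catalan` (the definition above) and `catalan_eq_sub : G = Σ_k 1/(4k+1)² − Σ_k 1/(4k+3)²`
  (`tsum_even_add_odd`);
* `catalan ∈ [0.915965594177202, 0.915965594177234]` (`catalan_mem_catalanI`, width `3.2·10⁻¹⁴`), as the
  `ℚ × ℚ` pair `catalanI`.
Method: each half `Σ_k 1/(4k+c)²` (`c = 1, 3`; `x = k + c/4`, term `1/(16x²)`) gets 30 exact head terms and
the two-sided Kummer tail of `ExclusionSentencesZetaValues.lean` with half-integer products:
`1/x² = E₁ − ¼E₂ + (9/16)E₃ − (225/64)E₄ + (11025/256) v₅`, `E_j(x) = 1/∏(x+i)` over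
`i ∈ {−(2j−1)/2, …, (2j−1)/2}` `= b_j(x) − b_j(x+1)`, `b_j(x) = 1/((2j−1)∏_{i=-(2j-1)/2}^{(2j-3)/2}(x+i))`,
`0 ≤ v₅ = 1/(x²∏_{i≤4}(x² − (2i−1)²/4)) ≤ E₅`.  Every termwise inequality is a rational-function identity
(`field_simp; ring`) with a manifestly positive slack.  Exact design / cross-check:
`HOME/pub-ising3x-recog-1/lean/tools/zeta_catalan_design.py`.  No 3D digit is used anywhere.
-/

namespace Summit.CriticalPhenomena.Ising3D

open Filter Topology Finset

/-- Catalan's constant `G = Σ_{n≥0} (−1)ⁿ/(2n+1)²`. -/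
noncomputable def catalan : ℝ := ∑' n : ℕ, (-1) ^ n / (2 * (n : ℝ) + 1) ^ 2

/-- Summability of `k ↦ 1/(4k + c)²` for `1 ≤ c` (comparison with `1/(k+1)²`). -/
theorem summable_inv_sq_lin {c : ℝ} (hc : 1 ≤ c) :
    Summable (fun k : ℕ => 1 / (4 * (k : ℝ) + c) ^ 2) := by
  have h2 : Summable (fun k : ℕ => 1 / ((k : ℝ) + 1) ^ 2) := by
    have h := (summable_nat_add_iff 1).mpr (Real.summable_one_div_nat_pow.mpr (by norm_num : 1 < 2))
    simpa [Nat.cast_add, Nat.cast_one] using h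
  refine Summable.of_nonneg_of_le (fun k => by positivity) (fun k => ?_) h2
  have hk : (0 : ℝ) ≤ k := Nat.cast_nonneg k
  exact one_div_le_one_div_of_le (by positivity) (pow_le_pow_left₀ (by positivity) (by linarith) 2)

/-- `G = Σ_k 1/(4k+1)² − Σ_k 1/(4k+3)²` (even and odd terms of the alternating series). -/
theorem catalan_eq_sub :
    catalan = ∑' k : ℕ, 1 / (4 * (k : ℝ) + 1) ^ 2 - ∑' k : ℕ, 1 / (4 * (k : ℝ) + 3) ^ 2 := by
  set f : ℕ → ℝ := fun n => (-1) ^ n / (2 * (n : ℝ) + 1) ^ 2 with hf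
  have he' : (fun k : ℕ => f (2 * k)) = fun k : ℕ => 1 / (4 * (k : ℝ) + 1) ^ 2 := by
    funext k; simp only [hf]; push_cast
    rw [pow_mul]; norm_num; ring
  have ho' : (fun k : ℕ => f (2 * k + 1)) = fun k : ℕ => -(1 / (4 * (k : ℝ) + 3) ^ 2) := by
    funext k; simp only [hf]; push_cast
    rw [pow_succ, pow_mul]; norm_num; ring
  have he : Summable (fun k : ℕ => f (2 * k)) := by
    rw [he']; exact summable_inv_sq_lin le_rfl
  have ho : Summable (fun k : ℕ => f (2 * k + 1)) := by
    rw [ho']; exact (summable_inv_sq_lin (by norm_num : (1 : ℝ) ≤ 3)).neg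
  have h := tsum_even_add_odd he ho
  rw [he', ho', tsum_neg] at h
  rw [catalan, ← h]
  ring

/-! ### Tail potentials for `Σ_k 1/(4k+1)²` after 30 head terms (`x = k + 1/4 = m + 121 / 4`) -/

/-- `b₁(x)/1 = 1/(x − ½)` at `x = m + 121 / 4` (`Σ 1/(4k+1)²`). -/
noncomputable def g1b1 (m : ℕ) : ℝ :=
  (1 : ℝ) / 1 * ((m : ℝ) + 119 / 4)⁻¹

/-- `b₂(x) = 1/(3(x−3/2)(x−½)(x+½))`. -/
noncomputable def g1b2 (m : ℕ) : ℝ :=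
  (1 : ℝ) / 3 * ((m : ℝ) + 115 / 4)⁻¹ * ((m : ℝ) + 119 / 4)⁻¹ * ((m : ℝ) + 123 / 4)⁻¹

/-- `b₃(x) = 1/(5∏_{i=-5/2}^{3/2}(x+i))`. -/
noncomputable def g1b3 (m : ℕ) : ℝ :=
  (1 : ℝ) / 5 * ((m : ℝ) + 111 / 4)⁻¹ * ((m : ℝ) + 115 / 4)⁻¹ * ((m : ℝ) + 119 / 4)⁻¹ *
    ((m : ℝ) + 123 / 4)⁻¹ * ((m : ℝ) + 127 / 4)⁻¹

/-- `b₄(x) = 1/(7∏_{i=-7/2}^{5/2}(x+i))`. -/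
noncomputable def g1b4 (m : ℕ) : ℝ :=
  (1 : ℝ) / 7 * ((m : ℝ) + 107 / 4)⁻¹ * ((m : ℝ) + 111 / 4)⁻¹ * ((m : ℝ) + 115 / 4)⁻¹ *
    ((m : ℝ) + 119 / 4)⁻¹ * ((m : ℝ) + 123 / 4)⁻¹ * ((m : ℝ) + 127 / 4)⁻¹ * ((m : ℝ) + 131 / 4)⁻¹

/-- `b₅(x) = 1/(9∏_{i=-9/2}^{7/2}(x+i))`. -/
noncomputable def g1b5 (m : ℕ) : ℝ :=
  (1 : ℝ) / 9 * ((m : ℝ) + 103 / 4)⁻¹ * ((m : ℝ) + 107 / 4)⁻¹ * ((m : ℝ) + 111 / 4)⁻¹ *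
    ((m : ℝ) + 115 / 4)⁻¹ * ((m : ℝ) + 119 / 4)⁻¹ * ((m : ℝ) + 123 / 4)⁻¹ * ((m : ℝ) + 127 / 4)⁻¹ *
    ((m : ℝ) + 131 / 4)⁻¹ * ((m : ℝ) + 135 / 4)⁻¹

/-- Lower potential for the tail of `Σ 1/(4k+1)²`: `(b₁ − ¼b₂ + (9/16)b₃ − (225/64)b₄)/16`. -/
noncomputable def g1lo (m : ℕ) : ℝ :=
  (g1b1 m - 1 / 4 * g1b2 m + 9 / 16 * g1b3 m - 225 / 64 * g1b4 m) / 16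

/-- Upper potential: `g1lo + (11025/256) b₅ / 16`. -/
noncomputable def g1hi (m : ℕ) : ℝ := g1lo m + 11025 / 256 * g1b5 m / 16

/-- `g1b1 → 0`. -/
theorem tendsto_g1b1 : Tendsto g1b1 atTop (𝓝 0) := by
  have h :=
    ((tendsto_const_nhds (x := ((1 : ℝ) / 1))).mul (tendsto_inv_natCast_add (119 / 4 : ℝ)))
  simp only [mul_zero] at h
  exact h.congr' (Eventually.of_forall fun m => by simp only [g1b1])

/-- `g1b2 → 0`. -/
theorem tendsto_g1b2 : Tendsto g1b2 atTop (𝓝 0) := by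
  have h :=
    ((((tendsto_const_nhds (x := ((1 : ℝ) / 3))).mul
      (tendsto_inv_natCast_add (115 / 4 : ℝ))).mul (tendsto_inv_natCast_add (119 / 4 : ℝ))).mul
      (tendsto_inv_natCast_add (123 / 4 : ℝ)))
  simp only [mul_zero] at h
  exact h.congr' (Eventually.of_forall fun m => by simp only [g1b2])

/-- `g1b3 → 0`. -/
theorem tendsto_g1b3 : Tendsto g1b3 atTop (𝓝 0) := by
  have h :=
    ((((((tendsto_const_nhds (x := ((1 : ℝ) / 5))).mul
      (tendsto_inv_natCast_add (111 / 4 : ℝ))).mul (tendsto_inv_natCast_add (115 / 4 : ℝ))).mul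
      (tendsto_inv_natCast_add (119 / 4 : ℝ))).mul (tendsto_inv_natCast_add (123 / 4 : ℝ))).mul
      (tendsto_inv_natCast_add (127 / 4 : ℝ)))
  simp only [mul_zero] at h
  exact h.congr' (Eventually.of_forall fun m => by simp only [g1b3])

/-- `g1b4 → 0`. -/
theorem tendsto_g1b4 : Tendsto g1b4 atTop (𝓝 0) := by
  have h :=
    ((((((((tendsto_const_nhds (x := ((1 : ℝ) / 7))).mul
      (tendsto_inv_natCast_add (107 / 4 : ℝ))).mul (tendsto_inv_natCast_add (111 / 4 : ℝ))).mul
      (tendsto_inv_natCast_add (115 / 4 : ℝ))).mul (tendsto_inv_natCast_add (119 / 4 : ℝ))).mul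
      (tendsto_inv_natCast_add (123 / 4 : ℝ))).mul (tendsto_inv_natCast_add (127 / 4 : ℝ))).mul
      (tendsto_inv_natCast_add (131 / 4 : ℝ)))
  simp only [mul_zero] at h
  exact h.congr' (Eventually.of_forall fun m => by simp only [g1b4])

/-- `g1b5 → 0`. -/
theorem tendsto_g1b5 : Tendsto g1b5 atTop (𝓝 0) := by
  have h :=
    ((((((((((tendsto_const_nhds (x := ((1 : ℝ) / 9))).mul
      (tendsto_inv_natCast_add (103 / 4 : ℝ))).mul (tendsto_inv_natCast_add (107 / 4 : ℝ))).mul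
      (tendsto_inv_natCast_add (111 / 4 : ℝ))).mul (tendsto_inv_natCast_add (115 / 4 : ℝ))).mul
      (tendsto_inv_natCast_add (119 / 4 : ℝ))).mul (tendsto_inv_natCast_add (123 / 4 : ℝ))).mul
      (tendsto_inv_natCast_add (127 / 4 : ℝ))).mul (tendsto_inv_natCast_add (131 / 4 : ℝ))).mul
      (tendsto_inv_natCast_add (135 / 4 : ℝ)))
  simp only [mul_zero] at h
  exact h.congr' (Eventually.of_forall fun m => by simp only [g1b5])

/-- `g1lo → 0`. -/
theorem tendsto_g1lo : Tendsto g1lo atTop (𝓝 0) := by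
  have h := (((tendsto_g1b1.sub (tendsto_g1b2.const_mul (1 / 4))).add
    (tendsto_g1b3.const_mul (9 / 16))).sub (tendsto_g1b4.const_mul (225 / 64))).div_const 16
  simp only [sub_zero, mul_zero, add_zero, zero_div] at h
  exact h.congr' (Eventually.of_forall fun m => by simp only [g1lo])

/-- `g1hi → 0`. -/
theorem tendsto_g1hi : Tendsto g1hi atTop (𝓝 0) := by
  have h := tendsto_g1lo.add ((tendsto_g1b5.const_mul (11025 / 256)).div_const 16)
  simp only [mul_zero, zero_div, add_zero] at h
  exact h.congr' (Eventually.of_forall fun m => by simp only [g1hi])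

/-- Termwise minorant for `Σ 1/(4k+1)²`: slack `(11025/4096) v₅ ≥ 0`. -/
theorem g1lo_step (m : ℕ) :
    g1lo m - g1lo (m + 1) ≤ 1 / (4 * (((m + 30 : ℕ) : ℝ)) + 1) ^ 2 := by
  have key : 1 / (4 * (((m + 30 : ℕ) : ℝ)) + 1) ^ 2 - (g1lo m - g1lo (m + 1)) =
      (11025 / 4096) /
      (((m : ℝ) + 107 / 4) * ((m : ℝ) + 111 / 4) * ((m : ℝ) + 115 / 4) * ((m : ℝ) + 119 / 4) *
        ((m : ℝ) + 121 / 4) ^ 2 * ((m : ℝ) + 123 / 4) * ((m : ℝ) + 127 / 4) * ((m : ℝ) + 131 / 4) *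
        ((m : ℝ) + 135 / 4)) := by
    simp only [g1lo, g1b1, g1b2, g1b3, g1b4]
    push_cast
    field_simp
    ring
  have : (0 : ℝ) ≤ (11025 / 4096) /
      (((m : ℝ) + 107 / 4) * ((m : ℝ) + 111 / 4) * ((m : ℝ) + 115 / 4) * ((m : ℝ) + 119 / 4) *
        ((m : ℝ) + 121 / 4) ^ 2 * ((m : ℝ) + 123 / 4) * ((m : ℝ) + 127 / 4) * ((m : ℝ) + 131 / 4) *
        ((m : ℝ) + 135 / 4)) := by
    positivity
  linarith

/-- Termwise majorant for `Σ 1/(4k+1)²`: slack `(11025/4096)(E₅ − v₅) = (893025/16384)/(x²∏_{i≤5}(…)) ≥ 0`. -/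
theorem g1hi_step (m : ℕ) :
    1 / (4 * (((m + 30 : ℕ) : ℝ)) + 1) ^ 2 ≤ g1hi m - g1hi (m + 1) := by
  have key : g1hi m - g1hi (m + 1) - 1 / (4 * (((m + 30 : ℕ) : ℝ)) + 1) ^ 2 =
      (893025 / 16384) /
      (((m : ℝ) + 103 / 4) * ((m : ℝ) + 107 / 4) * ((m : ℝ) + 111 / 4) * ((m : ℝ) + 115 / 4) *
        ((m : ℝ) + 119 / 4) * ((m : ℝ) + 121 / 4) ^ 2 * ((m : ℝ) + 123 / 4) * ((m : ℝ) + 127 / 4) *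
        ((m : ℝ) + 131 / 4) * ((m : ℝ) + 135 / 4) * ((m : ℝ) + 139 / 4)) := by
    simp only [g1hi, g1lo, g1b1, g1b2, g1b3, g1b4, g1b5]
    push_cast
    field_simp
    ring
  have : (0 : ℝ) ≤ (893025 / 16384) /
      (((m : ℝ) + 103 / 4) * ((m : ℝ) + 107 / 4) * ((m : ℝ) + 111 / 4) * ((m : ℝ) + 115 / 4) *
        ((m : ℝ) + 119 / 4) * ((m : ℝ) + 121 / 4) ^ 2 * ((m : ℝ) + 123 / 4) * ((m : ℝ) + 127 / 4) *
        ((m : ℝ) + 131 / 4) * ((m : ℝ) + 135 / 4) * ((m : ℝ) + 139 / 4)) := by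
    positivity
  linarith

/-! ### Tail potentials for `Σ_k 1/(4k+3)²` after 30 head terms (`x = k + 3/4 = m + 123 / 4`) -/

/-- `b₁(x)/1 = 1/(x − ½)` at `x = m + 123 / 4` (`Σ 1/(4k+3)²`). -/
noncomputable def g3b1 (m : ℕ) : ℝ :=
  (1 : ℝ) / 1 * ((m : ℝ) + 121 / 4)⁻¹

/-- `b₂(x) = 1/(3(x−3/2)(x−½)(x+½))`. -/
noncomputable def g3b2 (m : ℕ) : ℝ :=
  (1 : ℝ) / 3 * ((m : ℝ) + 117 / 4)⁻¹ * ((m : ℝ) + 121 / 4)⁻¹ * ((m : ℝ) + 125 / 4)⁻¹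

/-- `b₃(x) = 1/(5∏_{i=-5/2}^{3/2}(x+i))`. -/
noncomputable def g3b3 (m : ℕ) : ℝ :=
  (1 : ℝ) / 5 * ((m : ℝ) + 113 / 4)⁻¹ * ((m : ℝ) + 117 / 4)⁻¹ * ((m : ℝ) + 121 / 4)⁻¹ *
    ((m : ℝ) + 125 / 4)⁻¹ * ((m : ℝ) + 129 / 4)⁻¹

/-- `b₄(x) = 1/(7∏_{i=-7/2}^{5/2}(x+i))`. -/
noncomputable def g3b4 (m : ℕ) : ℝ :=
  (1 : ℝ) / 7 * ((m : ℝ) + 109 / 4)⁻¹ * ((m : ℝ) + 113 / 4)⁻¹ * ((m : ℝ) + 117 / 4)⁻¹ *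
    ((m : ℝ) + 121 / 4)⁻¹ * ((m : ℝ) + 125 / 4)⁻¹ * ((m : ℝ) + 129 / 4)⁻¹ * ((m : ℝ) + 133 / 4)⁻¹

/-- `b₅(x) = 1/(9∏_{i=-9/2}^{7/2}(x+i))`. -/
noncomputable def g3b5 (m : ℕ) : ℝ :=
  (1 : ℝ) / 9 * ((m : ℝ) + 105 / 4)⁻¹ * ((m : ℝ) + 109 / 4)⁻¹ * ((m : ℝ) + 113 / 4)⁻¹ *
    ((m : ℝ) + 117 / 4)⁻¹ * ((m : ℝ) + 121 / 4)⁻¹ * ((m : ℝ) + 125 / 4)⁻¹ * ((m : ℝ) + 129 / 4)⁻¹ *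
    ((m : ℝ) + 133 / 4)⁻¹ * ((m : ℝ) + 137 / 4)⁻¹

/-- Lower potential for the tail of `Σ 1/(4k+3)²`: `(b₁ − ¼b₂ + (9/16)b₃ − (225/64)b₄)/16`. -/
noncomputable def g3lo (m : ℕ) : ℝ :=
  (g3b1 m - 1 / 4 * g3b2 m + 9 / 16 * g3b3 m - 225 / 64 * g3b4 m) / 16

/-- Upper potential: `g3lo + (11025/256) b₅ / 16`. -/
noncomputable def g3hi (m : ℕ) : ℝ := g3lo m + 11025 / 256 * g3b5 m / 16

/-- `g3b1 → 0`. -/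
theorem tendsto_g3b1 : Tendsto g3b1 atTop (𝓝 0) := by
  have h :=
    ((tendsto_const_nhds (x := ((1 : ℝ) / 1))).mul (tendsto_inv_natCast_add (121 / 4 : ℝ)))
  simp only [mul_zero] at h
  exact h.congr' (Eventually.of_forall fun m => by simp only [g3b1])

/-- `g3b2 → 0`. -/
theorem tendsto_g3b2 : Tendsto g3b2 atTop (𝓝 0) := by
  have h :=
    ((((tendsto_const_nhds (x := ((1 : ℝ) / 3))).mul
      (tendsto_inv_natCast_add (117 / 4 : ℝ))).mul (tendsto_inv_natCast_add (121 / 4 : ℝ))).mul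
      (tendsto_inv_natCast_add (125 / 4 : ℝ)))
  simp only [mul_zero] at h
  exact h.congr' (Eventually.of_forall fun m => by simp only [g3b2])

/-- `g3b3 → 0`. -/
theorem tendsto_g3b3 : Tendsto g3b3 atTop (𝓝 0) := by
  have h :=
    ((((((tendsto_const_nhds (x := ((1 : ℝ) / 5))).mul
      (tendsto_inv_natCast_add (113 / 4 : ℝ))).mul (tendsto_inv_natCast_add (117 / 4 : ℝ))).mul
      (tendsto_inv_natCast_add (121 / 4 : ℝ))).mul (tendsto_inv_natCast_add (125 / 4 : ℝ))).mul
      (tendsto_inv_natCast_add (129 / 4 : ℝ)))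
  simp only [mul_zero] at h
  exact h.congr' (Eventually.of_forall fun m => by simp only [g3b3])

/-- `g3b4 → 0`. -/
theorem tendsto_g3b4 : Tendsto g3b4 atTop (𝓝 0) := by
  have h :=
    ((((((((tendsto_const_nhds (x := ((1 : ℝ) / 7))).mul
      (tendsto_inv_natCast_add (109 / 4 : ℝ))).mul (tendsto_inv_natCast_add (113 / 4 : ℝ))).mul
      (tendsto_inv_natCast_add (117 / 4 : ℝ))).mul (tendsto_inv_natCast_add (121 / 4 : ℝ))).mul
      (tendsto_inv_natCast_add (125 / 4 : ℝ))).mul (tendsto_inv_natCast_add (129 / 4 : ℝ))).mul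
      (tendsto_inv_natCast_add (133 / 4 : ℝ)))
  simp only [mul_zero] at h
  exact h.congr' (Eventually.of_forall fun m => by simp only [g3b4])

/-- `g3b5 → 0`. -/
theorem tendsto_g3b5 : Tendsto g3b5 atTop (𝓝 0) := by
  have h :=
    ((((((((((tendsto_const_nhds (x := ((1 : ℝ) / 9))).mul
      (tendsto_inv_natCast_add (105 / 4 : ℝ))).mul (tendsto_inv_natCast_add (109 / 4 : ℝ))).mul
      (tendsto_inv_natCast_add (113 / 4 : ℝ))).mul (tendsto_inv_natCast_add (117 / 4 : ℝ))).mul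
      (tendsto_inv_natCast_add (121 / 4 : ℝ))).mul (tendsto_inv_natCast_add (125 / 4 : ℝ))).mul
      (tendsto_inv_natCast_add (129 / 4 : ℝ))).mul (tendsto_inv_natCast_add (133 / 4 : ℝ))).mul
      (tendsto_inv_natCast_add (137 / 4 : ℝ)))
  simp only [mul_zero] at h
  exact h.congr' (Eventually.of_forall fun m => by simp only [g3b5])

/-- `g3lo → 0`. -/
theorem tendsto_g3lo : Tendsto g3lo atTop (𝓝 0) := by
  have h := (((tendsto_g3b1.sub (tendsto_g3b2.const_mul (1 / 4))).add
    (tendsto_g3b3.const_mul (9 / 16))).sub (tendsto_g3b4.const_mul (225 / 64))).div_const 16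
  simp only [sub_zero, mul_zero, add_zero, zero_div] at h
  exact h.congr' (Eventually.of_forall fun m => by simp only [g3lo])

/-- `g3hi → 0`. -/
theorem tendsto_g3hi : Tendsto g3hi atTop (𝓝 0) := by
  have h := tendsto_g3lo.add ((tendsto_g3b5.const_mul (11025 / 256)).div_const 16)
  simp only [mul_zero, zero_div, add_zero] at h
  exact h.congr' (Eventually.of_forall fun m => by simp only [g3hi])

/-- Termwise minorant for `Σ 1/(4k+3)²`: slack `(11025/4096) v₅ ≥ 0`. -/
theorem g3lo_step (m : ℕ) :
    g3lo m - g3lo (m + 1) ≤ 1 / (4 * (((m + 30 : ℕ) : ℝ)) + 3) ^ 2 := by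
  have key : 1 / (4 * (((m + 30 : ℕ) : ℝ)) + 3) ^ 2 - (g3lo m - g3lo (m + 1)) =
      (11025 / 4096) /
      (((m : ℝ) + 109 / 4) * ((m : ℝ) + 113 / 4) * ((m : ℝ) + 117 / 4) * ((m : ℝ) + 121 / 4) *
        ((m : ℝ) + 123 / 4) ^ 2 * ((m : ℝ) + 125 / 4) * ((m : ℝ) + 129 / 4) * ((m : ℝ) + 133 / 4) *
        ((m : ℝ) + 137 / 4)) := by
    simp only [g3lo, g3b1, g3b2, g3b3, g3b4]
    push_cast
    field_simp
    ring
  have : (0 : ℝ) ≤ (11025 / 4096) /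
      (((m : ℝ) + 109 / 4) * ((m : ℝ) + 113 / 4) * ((m : ℝ) + 117 / 4) * ((m : ℝ) + 121 / 4) *
        ((m : ℝ) + 123 / 4) ^ 2 * ((m : ℝ) + 125 / 4) * ((m : ℝ) + 129 / 4) * ((m : ℝ) + 133 / 4) *
        ((m : ℝ) + 137 / 4)) := by
    positivity
  linarith

/-- Termwise majorant for `Σ 1/(4k+3)²`: slack `(11025/4096)(E₅ − v₅) = (893025/16384)/(x²∏_{i≤5}(…)) ≥ 0`. -/
theorem g3hi_step (m : ℕ) :
    1 / (4 * (((m + 30 : ℕ) : ℝ)) + 3) ^ 2 ≤ g3hi m - g3hi (m + 1) := by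
  have key : g3hi m - g3hi (m + 1) - 1 / (4 * (((m + 30 : ℕ) : ℝ)) + 3) ^ 2 =
      (893025 / 16384) /
      (((m : ℝ) + 105 / 4) * ((m : ℝ) + 109 / 4) * ((m : ℝ) + 113 / 4) * ((m : ℝ) + 117 / 4) *
        ((m : ℝ) + 121 / 4) * ((m : ℝ) + 123 / 4) ^ 2 * ((m : ℝ) + 125 / 4) * ((m : ℝ) + 129 / 4) *
        ((m : ℝ) + 133 / 4) * ((m : ℝ) + 137 / 4) * ((m : ℝ) + 141 / 4)) := by
    simp only [g3hi, g3lo, g3b1, g3b2, g3b3, g3b4, g3b5]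
    push_cast
    field_simp
    ring
  have : (0 : ℝ) ≤ (893025 / 16384) /
      (((m : ℝ) + 105 / 4) * ((m : ℝ) + 109 / 4) * ((m : ℝ) + 113 / 4) * ((m : ℝ) + 117 / 4) *
        ((m : ℝ) + 121 / 4) * ((m : ℝ) + 123 / 4) ^ 2 * ((m : ℝ) + 125 / 4) * ((m : ℝ) + 129 / 4) *
        ((m : ℝ) + 133 / 4) * ((m : ℝ) + 137 / 4) * ((m : ℝ) + 141 / 4)) := by
    positivity
  linarith

/-- The certified enclosure of Catalan's constant: `[0.915965594177202, 0.915965594177234]`. -/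
def catalanI : ℚ × ℚ := (915965594177202 / 10 ^ 15, 915965594177234 / 10 ^ 15)

/-- **`G ∈ catalanI`.** -/
theorem catalan_mem_catalanI : catalan ∈ InI catalanI := by
  obtain ⟨h1, h2⟩ := tsum_mem_of_telescoping 30 (summable_inv_sq_lin le_rfl) g1lo_step g1hi_step
    tendsto_g1lo tendsto_g1hi
  obtain ⟨h3, h4⟩ := tsum_mem_of_telescoping 30 (summable_inv_sq_lin (by norm_num : (1 : ℝ) ≤ 3))
    g3lo_step g3hi_step tendsto_g3lo tendsto_g3hi
  rw [catalan_eq_sub]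
  set A := ∑' k : ℕ, 1 / (4 * (k : ℝ) + 1) ^ 2 with hA
  set B := ∑' k : ℕ, 1 / (4 * (k : ℝ) + 3) ^ 2 with hB
  norm_num [sum_range_succ, g1lo, g1hi, g1b1, g1b2, g1b3, g1b4, g1b5, g3lo, g3hi, g3b1, g3b2, g3b3,
    g3b4, g3b5] at h1 h2 h3 h4
  refine ⟨?_, ?_⟩
  · simp only [catalanI]; push_cast; linarith
  · simp only [catalanI]; push_cast; linarith

end Summit.CriticalPhenomena.Ising3D
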